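import Literature.MathematicalPhysics.QuantumFieldTheory.Balaban1983to89.B6RandomWalkInputNorm
import Literature.MathematicalPhysics.QuantumFieldTheory.Balaban1983to89.B6Ineq2133TwoScaleV1

/-!
# `Balaban1983to89.B6Ineq112NormSuppTS` — T. Bałaban, *Propagators and renormalization transformations for lattice gauge theories. II*,
# Commun. Math. Phys. **96** (1984) 223–250 [Balaban1984PropagatorsII], Prop. 2.5 p. 246 / (2.138) p. 247 with [Balaban1984PropagatorsI] Prop. 1.2 (1.112)
# p. 36: THE TWO-DIFFERENCE MEMBER `∇_μG_□∇_λ*` AS AN ADMISSIBLE-INPUT BLOCK MAJORANT on the member geometry `tsGeo` — the `HasMajorantA`/`NormSupp` form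
# of p38's `prop25_ineq112` (the member-side adapter, step (C1) of `lit-balaban-p27/PLAN-2138-legs-g90.md`)

statement-level skeleton of published theorems with citation tags; proofs where landed; nothing here is a claim about the Yang–Mills mass gap

PDF held: `paper:balaban1984-cmp96-propagators-rt-ii` (journal page = PDF page + 222), p. 246 [PDF 24] (Prop. 2.5), p. 247 [PDF 25] ((2.133), (2.138));
[Balaban1984PropagatorsI] `paper:balaban1984-cmp95-propagators-rt-i`, Prop. 1.2 (1.112) p. 36 as quoted in `…B6Prop25Eq112TwoScaleV1`:
*"|(∇G∇*J)(x)| ≤ O(1)e^{−δ₀|y−y′|}(‖J‖_ε + |J|) for 0 < ε < 1, x ∈ Δ̃(y), supp J ⊂ Δ̃(y′)"*.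

CITATION HEADER (lean-in-tree rule) — WHAT IS REPRODUCED.  Phase-2 file of the `lit-balaban` typed skeleton (HOME `run/shared/lean/pub/lit-balaban/`), seat
**p27 gen 90** (TAKING HOME/STATUS 2026-08-24T22:31Z on p38 g34's named offer; B6 fold owner r03); SKELETON rows B6.Prop2.5 × B6.Eq2.133 × B6.Eq2.138
(cells only; decls of record untouched).  p38 g22's member theorem `…B6Prop25Eq112TwoScaleV1.prop25_ineq112` states (1.112) for the genuine two-scale
`G_□` with the input data as two numbers (`|J| ≤ X`, Hölder quotients `≤ X_ε·(|b₋ − b₋′|_∞/L^j)^ε`) and a radius `r`; r03's `…B6Prop25TwoScaleCensus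
.ineq112_TS` reads it in the census functionals (`e4TS`, `holderTS`, `supNormTS`).  THIS FILE reads it in the majorant calculus of `…B6RandomWalkInputNorm`:
* **`ineq112_hasMajorantA`** — for every `0 < ε < 1` ONE `(δ, C_ε)` (δ on `d, L, a₀, a₁` only) such that for every member `i`, directions `μ, λ`:
  `HasMajorantA (tsGeo i R M) (y(·)) (NormSupp (y(·)) (fun y′ ↦ Δ̃(y′)) (fun _ J ↦ ‖J‖_ε + |J|)) (∇_μ G_□ ∇_λ*) (C_ε·e^{−δ|y−y′|_T})` — the block map
  `y(b) = iterBlockOf i.j b₋` of `…B6Ineq2133TwoScaleV1.ineq2133_G`, the region `Δ̃(y′) = {y″ : |y″ − y′|_T ≤ 1}` (the `3^{d+1}` blocks, r03's `InCube`),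
  the size functional `i.hqB ε J + i.supNormTS (.vec J)` (r03's `holderTS`/`supNormTS` on a single bond field), the operator `onFun (i.Dl μ ∘ i.G ∘ i.Dla λ)`
  (r03's `Dl`, `G`, `Dla`); proof = `prop25_ineq112` at `r = 1`, `X = |J|`, `X_ε = ‖J‖_ε` (`abs_sub_le_hqB`, the single-field version of r03's
  `abs_sub_le_holderTS_ten`), output block = the block of the output bond itself (distance `0 ≤ 1`), so the bound holds at EVERY output bond;
* v1.1 **`ineq112_hasMajorantA_rad`** — the same at a general input radius `r ≥ 0` (region `{y″ : |y″ − y′|_T ≤ r}`, constant `C_ε·e^{(1+2δ)(r+3)}` of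
  `prop25_ineq112`): the k-level transplant reads a census input supported in ONE block of level `j₀ + 1` as a member input spread over `L^{d+1}`
  blocks of `T_□`, i.e. of radius `L − 1` (`…B6CubeNormSuppInDecayV1`); `ineq112_hasMajorantA` is the case `r = 1`.
THEOREMS ONLY; no `def`, no `def … : Prop` fact; standard axioms.  Imports `…B6RandomWalkInputNorm` (p382304 ✓) and `…B6Ineq2133TwoScaleV1`.

HONEST SCOPE.  One two-scale member on its own torus `T_□`, in `T^{(j)}` units, per pair of directions; the constant is `C_ε·e^{4(1+2δ)}` of
`prop25_ineq112` at radius 1 (v1.1: radius `r`).  The k-level transplant to the V1 torus (PLAN steps (C3)–(C4)) is NOT here.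
NOT summit progress.  Unit `lit-balaban-p27` (gen 90), 2026-08-24; v1.1 2026-08-25 (adds `ineq112_hasMajorantA_rad`, re-derives the `r = 1` case from it).
-/

noncomputable section

open scoped InnerProductSpace BigOperators
open Finset

namespace Literature.MathematicalPhysics.QuantumFieldTheory.Balaban1983to89.B6Ineq112NormSuppTS

open LatticeFieldCalculus B5Eq117TorusCarriers B6SectAOperatorsV1 B6SectCOperators B6SectCTwoScaleV1 B6SectCTwoScaleV1Lattice
open BalabanImbrieJaffe1984to88.BIJ85AxialPropagator411 (BondSpace)
open B4TorusKernel.MultiPeriod (torusSupNorm torusSupNorm_nonneg)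
open B6LowerBound2153Torus (rep)
open B5Eq118OneStroke (iterBlockOf)
open B6Prop25TwoScaleCensus (TSIdx)
open B6Prop25TwoScaleCensus.TSIdx
open B6Prop25Eq112TwoScaleV1 (prop25_ineq112)
open B6Ineq2133TwoScaleV1 (tsGeo onFun onFun_apply tsGeo_dist_self)
open B6BlockDecayCalculus (torusDist_isPseudoDist)
open B6RandomWalkInputNorm (HasMajorantA NormSupp)

variable {d L : ℕ} {hd : 1 ≤ d + 1} {hL : Odd L ∧ 1 < L} {a₀ a₁ : ℝ}

/-- **the Hölder hypothesis of p38's (1.112) member theorem with `X_ε = ‖J‖_ε`, single bond field**: for `ε > 0` and same-direction fine bonds `b, b′`,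
`|J(b) − J(b′)| ≤ ‖J‖_ε·(|b₋ − b₋′|_∞/L^j)^ε` (r03's `abs_sub_le_holderTS_ten` for the `.vec` kind).
[cite: Balaban1984PropagatorsI, (1.109) p.35, Prop. 1.2 (1.112) p.36 («‖J‖_ε»)] -/
theorem abs_sub_le_hqB (i : TSIdx d L hd hL a₀ a₁) {ε : ℝ} (hε : 0 < ε) (J : BondSpace i.P) (b b' : PBond i.P 0)
    (hdir : b.dir = b'.dir) : |J b - J b'| ≤ i.hqB ε J * i.fdist b.src b'.src ^ ε := by
  classical
  by_cases hs : b.src = b'.src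
  · have hbb : b = b' := by
      obtain ⟨s, e⟩ := b
      obtain ⟨s', e'⟩ := b'
      simp only at hs hdir
      subst hs
      subst hdir
      rfl
    subst hbb
    have h0 : i.fdist b.src b.src = 0 := by
      rw [fdist_eq, (B3TorusRadialSums.supDist_eq_zero_iff b.src b.src).2 rfl, Nat.cast_zero, zero_div]
    rw [sub_self, abs_zero, h0, Real.zero_rpow hε.ne', mul_zero]
  · have hpos : 0 < i.fdist b.src b'.src ^ ε := Real.rpow_pos_of_pos (i.fdist_pos hs) _
    have h1 : ‖(J b' - J b) / i.fdist b.src b'.src ^ ε‖ ≤ i.hqB ε J := by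
      unfold TSIdx.hqB
      exact LatticeNorms.norm_le_supNorm (fun p : PBond i.P 0 × PBond i.P 0 => (J p.2 - J p.1) / i.fdist p.1.src p.2.src ^ ε)
        (Finset.mem_filter.2 ⟨Finset.mem_univ (b, b'), hs, hdir⟩)
    rw [Real.norm_eq_abs, abs_div, abs_of_pos hpos, div_le_iff₀ hpos, abs_sub_comm] at h1
    exact h1

/-- **PROP. 2.5 / (1.112) AS AN ADMISSIBLE-INPUT BLOCK MAJORANT ON THE MEMBER GEOMETRY, INPUT RADIUS `r`** (v1.1): for every `0 < ε < 1`
there is `C_ε ≥ 0` (and ONE rate `δ > 0` on `d, L, a₀, a₁`) such that for every radius `r ≥ 0`, every member `i` of the genuine two-scale family and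
directions `μ, λ`: `∇_μ G_□ ∇_λ* ≺_adm C_ε·e^{(1+2δ)(r+3)}·e^{−δ|y−y′|_T}` on `tsGeo`, for the class of fine bond fields supported over the blocks within
`|·|_T`-distance `r` of `y′` with `‖J‖_ε + |J| ≤ B`.
[cite: Balaban1984PropagatorsII, Prop. 2.5 p.246 + (2.138) p.247; Balaban1984PropagatorsI, Prop. 1.2 (1.112) p.36] -/
theorem ineq112_hasMajorantA_rad (d L : ℕ) (hd : 1 ≤ d + 1) (hL : Odd L ∧ 1 < L) {a₀ a₁ : ℝ} (ha₀ : 0 < a₀) (ha₁ : a₀ ≤ a₁) :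
    ∃ δ : ℝ, 0 < δ ∧ ∀ ε : ℝ, 0 < ε → ε < 1 → ∃ C : ℝ, 0 ≤ C ∧ ∀ (r : ℝ), 0 ≤ r → ∀ (i : TSIdx d L hd hL a₀ a₁) (R M : ℝ) (mu lam : Fin i.P.d),
      HasMajorantA (g := tsGeo i R M) (fun b : PBond i.P 0 => iterBlockOf i.j b.src)
        (NormSupp (g := tsGeo i R M) (fun b : PBond i.P 0 => iterBlockOf i.j b.src) (fun y' => {y'' | i.tdist y'' y' ≤ r})
          (fun _ μ => i.hqB ε (WithLp.toLp 2 μ) + i.supNormTS (.vec (WithLp.toLp 2 μ))))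
        (onFun (i.Dl mu ∘ₗ i.G ∘ₗ i.Dla lam))
        (fun y y' => C * Real.exp ((1 + 2 * δ) * (r + 3)) * Real.exp (-(δ * i.tdist y y'))) := by
  classical
  obtain ⟨δ, hδ, HE⟩ := prop25_ineq112 d L hd hL ha₀ ha₁
  refine ⟨δ, hδ, fun ε hε0 hε1 => ?_⟩
  obtain ⟨CE, hCE, hE⟩ := HE ε hε0 hε1
  refine ⟨CE, hCE, ?_⟩
  intro r hr i R M mu lam y' μ B hμ b₀
  set J : BondSpace i.P := WithLp.toLp 2 μ with hJdef
  show |onFun (i.Dl mu ∘ₗ i.G ∘ₗ i.Dla lam) μ b₀| ≤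
    CE * Real.exp ((1 + 2 * δ) * (r + 3)) * Real.exp (-(δ * i.tdist (iterBlockOf i.j b₀.src) y')) * B
  have hX0 : 0 ≤ i.supNormTS (.vec J) := i.supNormTS_nonneg _
  have hXε0 : 0 ≤ i.hqB ε J := i.hqB_nonneg ε J
  -- the input is supported over the blocks within `r` of `y′`
  have hsupp : ∀ b : PBond i.P 0, J b ≠ 0 → i.tdist (iterBlockOf i.j b.src) y' ≤ r := by
    intro b hb
    by_contra hnot
    exact hb (hμ.off b hnot)
  have hJb : ∀ b : PBond i.P 0, |J b| ≤ i.supNormTS (.vec J) := fun b => i.abs_le_supNormTS_vec J b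
  have hH : ∀ b b' : PBond i.P 0, b.dir = b'.dir → supDist b.src b'.src ≤ L ^ i.j →
      |J b - J b'| ≤ i.hqB ε J * (((supDist b.src b'.src : ℕ) : ℝ) / (L : ℝ) ^ i.j) ^ ε := by
    intro b b' hdir _
    rw [← i.fdist_eq b.src b'.src]
    exact abs_sub_le_hqB i hε0 J b b' hdir
  -- the output bond lies in its own block (distance `0 ≤ r`)
  have hout : i.tdist (iterBlockOf i.j b₀.src) (iterBlockOf i.j b₀.src) ≤ r := by
    rw [show i.tdist (iterBlockOf i.j b₀.src) (iterBlockOf i.j b₀.src) = 0 from tsGeo_dist_self i R M _]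
    exact hr
  have key := hE i.m i.K i.j i.hc i.hj i.Λ' i.w i.hw0 i.hw1 lam mu r hr J (i.supNormTS (.vec J)) (i.hqB ε J)
    hX0 hXε0 (iterBlockOf i.j b₀.src) y' hsupp hJb hH b₀ hout
  have hB : i.hqB ε J + i.supNormTS (.vec J) ≤ B := hμ.bound
  have hnn : 0 ≤ CE * Real.exp ((1 + 2 * δ) * (r + 3)) * Real.exp (-(δ * i.tdist (iterBlockOf i.j b₀.src) y')) := by positivity
  calc |onFun (i.Dl mu ∘ₗ i.G ∘ₗ i.Dla lam) μ b₀| = |i.Dl mu (i.G (i.Dla lam J)) b₀| := by rfl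
    _ ≤ CE * Real.exp ((1 + 2 * δ) * (r + 3)) * Real.exp (-(δ * i.tdist (iterBlockOf i.j b₀.src) y')) *
          (i.hqB ε J + i.supNormTS (.vec J)) := key
    _ ≤ CE * Real.exp ((1 + 2 * δ) * (r + 3)) * Real.exp (-(δ * i.tdist (iterBlockOf i.j b₀.src) y')) * B :=
        mul_le_mul_of_nonneg_left hB hnn

/-- **PROP. 2.5 / (1.112) AS AN ADMISSIBLE-INPUT BLOCK MAJORANT ON THE MEMBER GEOMETRY** (step (C1) of the (2.138) legs): for every `0 < ε < 1` there is
`C_ε ≥ 0` (and ONE rate `δ > 0` on `d, L, a₀, a₁`) such that for every member `i` of the genuine two-scale family and directions `μ, λ`: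
`∇_μ G_□ ∇_λ* ≺_adm C_ε·e^{−δ|y−y′|_T}` on `tsGeo`, for the class of fine bond fields supported over the cube `Δ̃(y′)` with `‖J‖_ε + |J| ≤ B`
(the case `r = 1` of `ineq112_hasMajorantA_rad`).
[cite: Balaban1984PropagatorsII, Prop. 2.5 p.246 + (2.138) p.247; Balaban1984PropagatorsI, Prop. 1.2 (1.112) p.36] -/
theorem ineq112_hasMajorantA (d L : ℕ) (hd : 1 ≤ d + 1) (hL : Odd L ∧ 1 < L) {a₀ a₁ : ℝ} (ha₀ : 0 < a₀) (ha₁ : a₀ ≤ a₁) :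
    ∃ δ : ℝ, 0 < δ ∧ ∀ ε : ℝ, 0 < ε → ε < 1 → ∃ C : ℝ, 0 ≤ C ∧ ∀ (i : TSIdx d L hd hL a₀ a₁) (R M : ℝ) (mu lam : Fin i.P.d),
      HasMajorantA (g := tsGeo i R M) (fun b : PBond i.P 0 => iterBlockOf i.j b.src)
        (NormSupp (g := tsGeo i R M) (fun b : PBond i.P 0 => iterBlockOf i.j b.src) (fun y' => {y'' | i.tdist y'' y' ≤ 1})
          (fun _ μ => i.hqB ε (WithLp.toLp 2 μ) + i.supNormTS (.vec (WithLp.toLp 2 μ))))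
        (onFun (i.Dl mu ∘ₗ i.G ∘ₗ i.Dla lam))
        (fun y y' => C * Real.exp (-(δ * i.tdist y y'))) := by
  obtain ⟨δ, hδ, HE⟩ := ineq112_hasMajorantA_rad d L hd hL ha₀ ha₁
  refine ⟨δ, hδ, fun ε hε0 hε1 => ?_⟩
  obtain ⟨C, hC, h⟩ := HE ε hε0 hε1
  exact ⟨C * Real.exp ((1 + 2 * δ) * (1 + 3)), by positivity, fun i R M mu lam => h 1 zero_le_one i R M mu lam⟩

end Literature.MathematicalPhysics.QuantumFieldTheory.Balaban1983to89.B6Ineq112NormSuppTS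

end
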